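/-
Copyright (c) 2026. All rights reserved.
Released under Apache 2.0 license as described in the file LICENSE.
Authors: abc-iut cell, campaign-S prover seat abc-iut-S7.
-/
import Literature.NumberTheory.NumberFields.RescaledCompletion
import Literature.NumberTheory.GaloisRepresentations.AdicCompletionUniformizer
import Literature.IUT.LogVolume.FundamentalIdentity
import HarnessLib

/-!
# The [IUTchIV] §1 invariants of a completion: `e(K_v) = e(v|p)`, `f(K_v) = f(v|p)`

For a number field `F` and a finite place `v ∣ p`, the completion `F_v` with its rescaled norm
(`RescaledCompletion F p v hv`, `Literature/NumberTheory/NumberFields/RescaledCompletion.lean`) is a field of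
the cell's MLF class, so the invariants of [IUTchIV] Prop. 1.2 (kurims p. 10: "`e_i` the ramification
index of `k_i` over `ℚ_p`", "`p^{f_i}` the cardinality of the residue field of `k_i`") defined in
`RamificationInvariants.lean` (`absRamificationIdx`, `residueDegree`, computed from norms) apply to it.
This file identifies them with the number-field invariants of Mathlib:
`absRamificationIdx p (F_v) = e(v|p) = v.asIdeal.ramificationIdx ℤ` and
`residueDegree p (F_v) = f(v|p) = v.asIdeal.inertiaDeg ℤ` — via a uniformizer of `F_v`
(`‖ϖ‖' = 𝐍(v)^{−1/n_v} = p^{−1/e}`, `‖p‖' = p^{−1}`) and the fundamental identity `e·f = [F_v : ℚ_p]`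
(`FundamentalIdentity.lean`, `CompletionLocalDegree.lean`).  Classical (Neukirch, ANT II (6.8), (8.5)).
[cite: NeukirchANT1999, Ch. II Prop. (6.8)]
-/

noncomputable section

open NumberField IsDedekindDomain Literature.NumberTheory.NumberFields
open Literature.NumberTheory.GaloisRepresentations Literature.NumberTheory.GaloisRepresentations.Ultrametric
open scoped NNReal

namespace Literature.IUT.LogVolume

variable (F : Type) [Field F] [NumberField F] (p : ℕ) [Fact p.Prime] (v : HeightOneSpectrum (𝓞 F))
  (hv : ((p : ℕ) : 𝓞 F) ∈ v.asIdeal)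

include hv in
/-- `𝔭_v` lies over `(p) ⊆ ℤ` when `p ∈ 𝔭_v`. [cite: NeukirchANT1999, Ch. I §8] -/
theorem liesOver_span_of_natCast_mem : v.asIdeal.LiesOver (Ideal.span {(p : ℤ)}) := by
  have hp : (p : ℤ) ≠ 0 := Int.natCast_ne_zero.mpr (Fact.out : p.Prime).ne_zero
  have hprime : (Ideal.span {(p : ℤ)}).IsPrime :=
    (Ideal.span_singleton_prime hp).mpr (Nat.prime_iff_prime_int.mp Fact.out)
  have hmax : (Ideal.span {(p : ℤ)}).IsMaximal := hprime.isMaximal (by simpa using hp)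
  refine ⟨hmax.eq_of_le (Ideal.comap_ne_top _ v.isMaximal.ne_top) ?_⟩
  rw [Ideal.span_le, Set.singleton_subset_iff]
  change algebraMap ℤ (𝓞 F) (p : ℤ) ∈ v.asIdeal
  simpa using hv

include hv in
/-- **`𝐍(v) = p^{f(v|p)}`** with `f(v|p) = v.asIdeal.inertiaDeg ℤ`. [cite: NeukirchANT1999, Ch. I §8] -/
theorem absNorm_eq_pow_inertiaDeg : Ideal.absNorm v.asIdeal = p ^ v.asIdeal.inertiaDeg ℤ := by
  have hp : (p : ℤ) ≠ 0 := Int.natCast_ne_zero.mpr (Fact.out : p.Prime).ne_zero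
  haveI : v.asIdeal.IsMaximal := v.isMaximal
  haveI := liesOver_span_of_natCast_mem F p v hv
  haveI : (Ideal.span {(p : ℤ)}).IsMaximal :=
    ((Ideal.span_singleton_prime hp).mpr (Nat.prime_iff_prime_int.mp Fact.out)).isMaximal
      (by simpa using hp)
  rw [Ideal.absNorm_eq_pow_inertiaDeg' v.asIdeal (Fact.out : p.Prime),
    Ideal.inertiaDeg'_eq_inertiaDeg (Ideal.span {(p : ℤ)}) v.asIdeal]

/-- **A norm uniformizer of the rescaled completion** with `‖ϖ‖' = p^{−1/e(v|p)}`: the image of a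
`π ∈ F` with `v(π) = 1`; its Mathlib norm is `𝐍(v)⁻¹ = p^{−f}`, and `(p^{−f})^{1/(ef)} = p^{−1/e}`.
[cite: NeukirchANT1999, Ch. II Prop. (6.8)] -/
theorem exists_isUniformizer_rescaledCompletion :
    ∃ ϖ : (RescaledCompletion F p v hv)ˣ, IsUniformizer ϖ ∧
      ‖(ϖ : RescaledCompletion F p v hv)‖ = (p : ℝ) ^ (-(1 / (v.asIdeal.ramificationIdx ℤ : ℝ))) := by
  obtain ⟨π, hπ⟩ := IsDedekindDomain.HeightOneSpectrum.valuation_exists_uniformizer F v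
  have hπ0 : (π : v.adicCompletion F) ≠ 0 := by
    intro h
    have : Valued.v (π : v.adicCompletion F) = 0 := by rw [h, map_zero]
    rw [IsDedekindDomain.HeightOneSpectrum.valuedAdicCompletion_eq_valuation', hπ] at this
    exact WithZero.coe_ne_zero this
  let ϖ₀ : (v.adicCompletion F)ˣ := Units.mk0 _ hπ0
  have hval : Valued.v (ϖ₀ : v.adicCompletion F) =
      ((Multiplicative.ofAdd (-1 : ℤ) : Multiplicative ℤ) : WithZero (Multiplicative ℤ)) := by
    change Valued.v (π : v.adicCompletion F) = _
    rw [IsDedekindDomain.HeightOneSpectrum.valuedAdicCompletion_eq_valuation', hπ]; rfl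
  letI : NontriviallyNormedField (v.adicCompletion F) := Ultrametric.AdicCompletion.nontriviallyNormedField F v
  obtain ⟨hu, hnorm⟩ := Ultrametric.AdicCompletion.isUniformizer_of_valuation_eq F v ϖ₀ hval
  -- transport to the rescaled norm: `‖·‖' = ‖·‖^s`, `s = 1/n_v`
  set s : ℝ := 1 / (localDeg F v : ℝ) with hs
  have hs0 : 0 < s := div_pos one_pos (by exact_mod_cast localDeg_pos F v)
  let ϖ : (RescaledCompletion F p v hv)ˣ := Units.map (RescaledCompletion.of F p v hv).toMonoidHom ϖ₀
  have hϖ : ‖(ϖ : RescaledCompletion F p v hv)‖ = ‖(ϖ₀ : v.adicCompletion F)‖ ^ s :=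
    RescaledCompletion.norm_of F p v hv _
  refine ⟨ϖ, ⟨?_, fun y => ?_⟩, ?_⟩
  · rw [hϖ]; exact Real.rpow_lt_one (norm_nonneg _) hu.1 hs0
  · obtain ⟨k, hk⟩ := hu.2 (Units.map (RescaledCompletion.of F p v hv).symm.toMonoidHom y)
    refine ⟨k, ?_⟩
    have hy : ‖(y : RescaledCompletion F p v hv)‖ =
        ‖((RescaledCompletion.of F p v hv).symm (y : RescaledCompletion F p v hv))‖ ^ s :=
      RescaledCompletion.norm_of F p v hv _
    rw [hy, hϖ, show ((Units.map (RescaledCompletion.of F p v hv).symm.toMonoidHom y :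
        (v.adicCompletion F)ˣ) : v.adicCompletion F) = (RescaledCompletion.of F p v hv).symm y from rfl] at *
    rw [hk, ← Real.rpow_intCast, ← Real.rpow_intCast, ← Real.rpow_mul (norm_nonneg _),
      ← Real.rpow_mul (norm_nonneg _), mul_comm]
  · rw [hϖ, hnorm, absNorm_eq_pow_inertiaDeg F p v hv, hs, localDeg]
    have hp : (0 : ℝ) < p := by exact_mod_cast (Fact.out : p.Prime).pos
    have he : (v.asIdeal.ramificationIdx ℤ : ℝ) ≠ 0 := by
      exact_mod_cast (Ideal.ramificationIdx_pos _ _).ne'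
    have hf : (v.asIdeal.inertiaDeg ℤ : ℝ) ≠ 0 := by exact_mod_cast (Ideal.inertiaDeg_pos _ _).ne'
    push_cast
    rw [← Real.rpow_natCast, ← Real.rpow_neg_one, ← Real.rpow_mul hp.le, ← Real.rpow_mul hp.le]
    congr 1
    field_simp

/-- **`e(F_v) = e(v|p)`**: the norm-defined absolute ramification index of the rescaled completion
(`RamificationInvariants.absRamificationIdx`, "`‖p‖ = ‖ϖ‖^e`") is `v.asIdeal.ramificationIdx ℤ`.
[cite: NeukirchANT1999, Ch. II Prop. (6.8)] -/
theorem absRamificationIdx_rescaledCompletion :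
    absRamificationIdx p (RescaledCompletion F p v hv) = v.asIdeal.ramificationIdx ℤ := by
  obtain ⟨ϖ, hϖ, hnorm⟩ := exists_isUniformizer_rescaledCompletion F p v hv
  have h := norm_prime_eq_norm_pow p (RescaledCompletion F p v hv) hϖ
  rw [norm_prime, hnorm, ← Real.rpow_natCast, ← Real.rpow_mul (by positivity)] at h
  have hp1 : (1 : ℝ) < p := by exact_mod_cast (Fact.out : p.Prime).one_lt
  have he : (v.asIdeal.ramificationIdx ℤ : ℝ) ≠ 0 := by exact_mod_cast (Ideal.ramificationIdx_pos _ _).ne'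
  -- `p⁻¹ = p^{-(e'/e)}` forces `e' = e`
  have h' : (p : ℝ) ^ (-1 : ℝ) = (p : ℝ) ^ (-(1 / (v.asIdeal.ramificationIdx ℤ : ℝ)) *
      (absRamificationIdx p (RescaledCompletion F p v hv) : ℝ)) := by
    rw [Real.rpow_neg_one]; exact h
  have hexp : (-1 : ℝ) = -(1 / (v.asIdeal.ramificationIdx ℤ : ℝ)) *
      (absRamificationIdx p (RescaledCompletion F p v hv) : ℝ) := by
    rcases lt_trichotomy (-1 : ℝ) (-(1 / (v.asIdeal.ramificationIdx ℤ : ℝ)) *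
      (absRamificationIdx p (RescaledCompletion F p v hv) : ℝ)) with hlt | heq | hgt
    · exact absurd h' (ne_of_lt ((Real.rpow_lt_rpow_left_iff hp1).mpr hlt))
    · exact heq
    · exact absurd h' (ne_of_gt ((Real.rpow_lt_rpow_left_iff hp1).mpr hgt))
  have : (absRamificationIdx p (RescaledCompletion F p v hv) : ℝ) = v.asIdeal.ramificationIdx ℤ := by
    field_simp at hexp
    linarith
  exact_mod_cast this

/-- **`f(F_v) = f(v|p)`**: the norm-defined residue degree of the rescaled completion
(`RamificationInvariants.residueDegree`, "`p^f` the cardinality of the residue field") is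
`v.asIdeal.inertiaDeg ℤ` — from `e·f = [F_v : ℚ_p]` on both sides. [cite: NeukirchANT1999, Ch. II Prop. (6.8)] -/
theorem residueDegree_rescaledCompletion :
    residueDegree p (RescaledCompletion F p v hv) = v.asIdeal.inertiaDeg ℤ := by
  have h1 := absRamificationIdx_mul_residueDegree p (RescaledCompletion F p v hv)
  have h2 : Module.finrank ℚ_[p] (RescaledCompletion F p v hv) = localDeg F v :=
    (RescaledCompletion.localDeg_eq_finrank F p v hv).symm
  rw [h2, localDeg, absRamificationIdx_rescaledCompletion] at h1
  exact Nat.eq_of_mul_eq_mul_left (Ideal.ramificationIdx_pos _ _) h1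

end Literature.IUT.LogVolume

end
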